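import Summits.Ventures.YMGap.YM3IR.Reindex
import HarnessLib

/-!
# YM3IR / ReindexPort — the SENDER's half of the A3 port lemma, file 2 of 2: link counts (iii), the meeting shape, the receiver door's real-valued line, the per-site sum re-indexing (iv-Σ)

HONEST FRAMING (cell pub-ymgap, track Y4 / YM3-IR, seat ym3ir-theory-1; second half of the tree edition of
`HOME/ym3ir/lean/Reindex-theory1.scratch.lean` v1.1 sha16 c762fb9eb6b4f98b, split at the gate's size lint; file 1 is
`YM3IR/Reindex.lean` = `cubeSites`, the seam, `reindex` + (i), the diameter exchange rate (ii); same namespace, every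
`def`/`theorem` of the scratch unchanged, its two joint-elaboration `example`s removed).  This file contains NO
conjecture name, NO `sorry`, NO axiom, and claims NO mass gap, NO continuum limit, NO part of Bałaban's theorems and NO
membership of any UV output in any ball: finite-torus counting and `Finset` bookkeeping about the re-indexed Literature
carrier.  Lead ruling R334 (A3 GO, G11): D3 = option (St) ADOPTED; the D3 port lemma ((iv-Σ) + the (St) corollary) is
theory-1's pen in the `Reindex` module; the RECEIVER's doors (β)/(γ)/(δ) and `steinerCard` (theory-2, port file M4
`YM3IR/ReceiverWitness.lean`) are neither imported nor restated — the halves meet at the HYPOTHESES produced below, and the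
joint (St) corollary (check record `HOME/ym3ir/lean/D3PortJoint-monolith-theory2.check.lean` 9b1d917dd32e05aa §J:
`inBall_reindex_of_sizeData`, `inBall_reindex_of_senderData`, `mem_clusterDomain_reindex_of_steinerData`) is filed once
both halves are in the tree.

* §4 the link count (iii): `#polymerEdges 1 Y = d·|Y|`, `#cubeSites c X ≤ c^d·|X|` (any `L`), so
  `#polymerEdges c X ≤ d·c^d·|X|`; EQUALITY `= d·c^d·|X|` when `c ∣ L` and `X` is a corner set (no truncated cubes) —
  the load half only consumes the inequality;
* §5 the MEETING SHAPE with the receiver's domination door: on the support of `reindex W` (`supNorm S ≠ 0`),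
  `S = cubeSites c X` for a polymer `X` with the same sup norm, and `polymerDiam S ≤ (s (corners S) − 1) + (c − 1)` for ANY
  size `s ≥ polymerDiam + 1` on polymers (Steiner branch) / `≤ c·#corners + (c − 1)` under range control (NO branch) /
  `#polymerEdges 1 S ≤ d·c^d·#corners` — the receiver's door hypotheses with rider constant `a = c − 1`, as theorems
  about `reindex W`;
* §6 the door's REAL-valued line produced (`size_nonneg`, `hdiam_of_supported`, `supported_supNorm_reindex`):
  `M S ≠ 0 → (polymerDiam S : ℝ) ≤ (st (corners S) − 1) + (c − 1)` for data `M` supported on the cube sets;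
* §7 the PER-SITE SUM RE-INDEXING (iv-Σ) `sum_polymersThrough_one_eq`
  (`∑_{S ∈ polymersThrough 1 y} f S = ∑_{X ∈ polymersThrough c (corner y)} f (cubeSites c X)` for `f` vanishing off the
  cube sets) and its two columns for `(reindex W).supNorm` — the sender's per-corner weighted norm
  `∑_{X ∋ corner y} ‖W_X‖ e^{κ_s (s X − 1)}` VERBATIM, and the `|S|` column with the `c^d` rider as a theorem.

NOT HERE / NOT CLAIMED: the load half (iv) ((St-real) ∧ (St-an) ⇒ `InBall κ_b ε₀ ε₁ (reindex W)` with the riders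
`e^{κ_b (c − 1)}`, `c^d`) is receiver-side (theory-2's doors); NO UV output is shown to meet the per-corner bounds inside
track Y2's radii; the cell's label of record stands («Bałaban statements AS
PRINTED with locators; ceilings are bookkeeping, no mass-gap / continuum / Clay claim», R196).
-/

noncomputable section

open Finset MeasureTheory
open Literature.MathematicalPhysics.QuantumFieldTheory
open Summit.Ventures.YMGap.RobustBall (polymerDiam Perturbation SUN mem_polymers_one torusNorm_sub_le_polymerDiam)

namespace Summit.Ventures.YMGap.YM3IR.Reindex

variable {d L N : ℕ} [NeZero L] {G : Type*} {c : ℕ}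

/-! ## §4 The link count (iii) -/

/-- At scale `1` the links of `Y` are `Y × (directions)`. [folklore] -/
theorem polymerEdges_one_eq_product (Y : Finset (Site d L)) :
    polymerEdges (d := d) (L := L) 1 Y = Y ×ˢ (univ : Finset (Fin d)) := by
  ext e
  simp [mem_product]

/-- At scale `1` a site set `Y` has `d·|Y|` links. [folklore] -/
theorem card_polymerEdges_one (Y : Finset (Site d L)) : (polymerEdges (d := d) (L := L) 1 Y).card = d * Y.card := by
  rw [polymerEdges_one_eq_product, card_product, card_univ, Fintype.card_fin, Nat.mul_comm]

/-- The cube sites of `X` are the union of the cubes labelled by `X`. [folklore] -/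
theorem cubeSites_eq_biUnion (X : Finset (Site d L)) :
    cubeSites c X = X.biUnion fun y => univ.filter fun x => blockCorner c x = y := by
  ext x
  simp

/-- **A corner set of `|X|` labels has at most `c^d·|X|` cube sites** (any torus side `L`; `c ≥ 1`). [folklore] -/
theorem card_cubeSites_le (hc : 0 < c) (X : Finset (Site d L)) : (cubeSites c X).card ≤ c ^ d * X.card := by
  rw [cubeSites_eq_biUnion]
  refine card_biUnion_le.trans ?_
  calc ∑ y ∈ X, (univ.filter fun x : Site d L => blockCorner c x = y).card ≤ ∑ _y ∈ X, c ^ d :=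
        sum_le_sum fun y _ => card_filter_blockCorner_eq_le hc y
    _ = c ^ d * X.card := by rw [sum_const, smul_eq_mul, Nat.mul_comm]

/-- **(iii, any torus) `#polymerEdges 1 (cubeSites c X) ≤ d·c^d·|X|`.** [folklore] -/
theorem card_polymerEdges_one_cubeSites_le (hc : 0 < c) (X : Finset (Site d L)) :
    (polymerEdges (d := d) (L := L) 1 (cubeSites c X)).card ≤ d * c ^ d * X.card := by
  rw [card_polymerEdges_one, Nat.mul_assoc]
  exact Nat.mul_le_mul_left d (card_cubeSites_le hc X)

/-- (iii, any torus) through the seam: `#polymerEdges c X ≤ d·c^d·|X|`. [folklore] -/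
theorem card_polymerEdges_le (hc : 0 < c) (X : Finset (Site d L)) :
    (polymerEdges (d := d) (L := L) c X).card ≤ d * c ^ d * X.card := by
  rw [← polymerEdges_one_cubeSites]
  exact card_polymerEdges_one_cubeSites_le hc X

/-! ### Equality when `c ∣ L` (no truncated cubes) -/

/-- When `c ∣ L`, a block-aligned coordinate is at most `L − c`. [folklore] -/
theorem val_add_lt_of_isBlockAligned (hcL : c ∣ L) {y : Site d L} (hy : IsBlockAligned c y)
    (i : Fin d) {a : ℕ} (ha : a < c) : (y i).val + a < L := by
  obtain ⟨k, hk⟩ := hy i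
  obtain ⟨m, hm⟩ := hcL
  have hyL : (y i).val < L := ZMod.val_lt _
  have hkm : k < m := Nat.lt_of_mul_lt_mul_left (a := c) (by rw [← hk, ← hm]; exact hyL)
  have h2 : c * (k + 1) ≤ c * m := Nat.mul_le_mul_left c hkm
  rw [Nat.mul_succ] at h2
  omega

/-- **A full cube has exactly `c^d` sites**: for `c ∣ L` and a block corner `y`, the sites with corner `y` are the
`y + a`, `a ∈ {0,…,c−1}^d`. [folklore] -/
theorem card_filter_blockCorner_eq (hc : 0 < c) (hcL : c ∣ L) {y : Site d L} (hy : y ∈ blockCorners c) :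
    (univ.filter fun x : Site d L => blockCorner c x = y).card = c ^ d := by
  have hal : IsBlockAligned c y := mem_blockCorners_iff.1 hy
  have hcL' : c ≤ L := Nat.le_of_dvd (Nat.pos_of_ne_zero (NeZero.ne L)) hcL
  let g : (Fin d → Fin c) → Site d L := fun a i => y i + ((a i : ℕ) : ZMod L)
  have hval : ∀ (a : Fin d → Fin c) (i : Fin d), (g a i).val = (y i).val + a i := by
    intro a i
    have ha : ((a i : ℕ) : ZMod L).val = a i := by
      rw [ZMod.val_natCast]; exact Nat.mod_eq_of_lt (lt_of_lt_of_le (a i).isLt hcL')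
    have hlt := val_add_lt_of_isBlockAligned hcL hal i (a i).isLt
    show (y i + ((a i : ℕ) : ZMod L)).val = _
    rw [ZMod.val_add_of_lt (by rw [ha]; exact hlt), ha]
  have hcorner : ∀ a, blockCorner c (g a) = y := by
    intro a
    funext i
    obtain ⟨k, hk⟩ := hal i
    simp only [blockCorner, hval a i, hk]
    rw [show (c * k + (a i : ℕ)) / c * c = c * k by
      rw [Nat.mul_comm c k, Nat.add_comm, Nat.add_mul_div_right _ _ hc, Nat.div_eq_of_lt (a i).isLt,
        Nat.zero_add]]
    rw [← hk, ZMod.natCast_zmod_val]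
  have hginj : Function.Injective g := by
    intro a a' h
    funext i
    have hi : (g a i).val = (g a' i).val := by rw [h]
    rw [hval, hval] at hi
    exact Fin.ext (by omega)
  have heq : (univ.filter fun x : Site d L => blockCorner c x = y) = univ.image g := by
    ext x
    simp only [mem_filter, mem_univ, true_and, mem_image]
    constructor
    · intro hx
      refine ⟨fun i => ⟨(x i).val % c, Nat.mod_lt _ hc⟩, funext fun i => ?_⟩
      have h := apply_sub_blockCorner c x i
      rw [hx, sub_eq_iff_eq_add'] at h
      exact h.symm
    · rintro ⟨a, rfl⟩
      exact hcorner a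
  rw [heq, card_image_of_injective _ hginj, card_univ, Fintype.card_fun, Fintype.card_fin, Fintype.card_fin]

/-- Distinct corners label disjoint cubes. [folklore] -/
theorem disjoint_filter_blockCorner {y y' : Site d L} (h : y ≠ y') :
    Disjoint (univ.filter fun x : Site d L => blockCorner c x = y)
      (univ.filter fun x : Site d L => blockCorner c x = y') := by
  refine disjoint_filter.2 fun x _ hx hx' => h ?_
  rw [← hx, ← hx']

/-- **For `c ∣ L` a corner set has exactly `c^d·|X|` cube sites.** [folklore] -/
theorem card_cubeSites_eq (hc : 0 < c) (hcL : c ∣ L) {X : Finset (Site d L)} (hX : X ∈ polymers c) :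
    (cubeSites c X).card = c ^ d * X.card := by
  rw [cubeSites_eq_biUnion, card_biUnion fun y _ y' _ h => disjoint_filter_blockCorner h]
  calc ∑ y ∈ X, (univ.filter fun x : Site d L => blockCorner c x = y).card = ∑ _y ∈ X, c ^ d :=
        sum_congr rfl fun y hy => card_filter_blockCorner_eq hc hcL (mem_polymers_iff.1 hX hy)
    _ = c ^ d * X.card := by rw [sum_const, smul_eq_mul, Nat.mul_comm]

/-- **(iii) of the note, exactly: `#polymerEdges 1 (cubeSites c X) = d·c^d·|X|`** for `c ∣ L` and a corner set
`X` (on a torus side not divisible by `c` only `≤` holds: `card_polymerEdges_one_cubeSites_le`). [folklore] -/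
theorem card_polymerEdges_one_cubeSites_eq (hc : 0 < c) (hcL : c ∣ L) {X : Finset (Site d L)}
    (hX : X ∈ polymers c) :
    (polymerEdges (d := d) (L := L) 1 (cubeSites c X)).card = d * c ^ d * X.card := by
  rw [card_polymerEdges_one, card_cubeSites_eq hc hcL hX, Nat.mul_assoc]

/-! ## §5 The MEETING SHAPE with the receiver's domination door (pen split, P2-LAWLEVEL-NOTE-theory2 v0.7.5 §9 «D3 FOLD» (c))

The receiver half (theory-2) takes an affine diameter bound ON THE SUPPORT of the scale-`1` datum as a HYPOTHESIS
(`M S ≠ 0 → polymerDiam S ≤ s S + a`).  The lemmas below deliver exactly that for `reindex W`, with `a = c − 1` and `s` read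
off the corner set `S.image (blockCorner c)` through ANY size function dominating `polymerDiam + 1` on polymers (theory-2's
`steinerCard` is one), so the two halves elaborate independently and meet at a hypothesis, not at an import. -/

section Meeting

variable [Group G] [MeasurableSpace G] (W : QuasiLocalGaugePerturbation d L G c)

/-- **Support of the re-indexed datum**: a site set with non-zero re-indexed sup norm is the cube set of a polymer `X`,
and carries the sup norm of `W_X`. [folklore] -/
theorem exists_eq_cubeSites_of_supNorm_ne_zero {S : Finset (Site d L)} (hS : (reindex W).supNorm S ≠ 0) :
    ∃ X ∈ polymers c, S = cubeSites c X ∧ (reindex W).supNorm S = W.supNorm X := by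
  by_cases h : cubeSites c (S.image (blockCorner c)) = S
  · refine ⟨S.image (blockCorner c), image_blockCorner_mem_polymers c S, h.symm, ?_⟩
    conv_lhs => rw [← h]
    exact supNorm_reindex_cubeSites W (image_blockCorner_mem_polymers c S)
  · exact absurd (supNorm_reindex_of_ne W h) hS

/-- A polymer with non-zero sup norm has a non-vanishing activity somewhere. [folklore] -/
theorem exists_act_ne_zero_of_supNorm_ne_zero {b : ℕ} (V : QuasiLocalGaugePerturbation d L G b) {X : Finset (Site d L)}
    (hX : V.supNorm X ≠ 0) : ∃ U, V.act X U ≠ 0 := by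
  by_contra hno
  simp only [not_exists, ne_eq, not_not] at hno
  exact hX (by simp [QuasiLocalGaugePerturbation.supNorm, hno])

/-- **MEETING SHAPE, Steiner branch (D3 = YES)**: on the support of `reindex W`,
`polymerDiam S ≤ (s (corners of S) − 1) + (c − 1)` for every size function `s` with `polymerDiam X + 1 ≤ s X` on polymers —
the receiver's door hypothesis with `a = c − 1`; no range control, no connectivity. [folklore] -/
theorem polymerDiam_le_of_supNorm_reindex_ne_zero (hc : 1 ≤ c) {s : Finset (Site d L) → ℕ}
    (hs : ∀ X ∈ polymers (d := d) (L := L) c, polymerDiam X + 1 ≤ s X) {S : Finset (Site d L)}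
    (hS : (reindex W).supNorm S ≠ 0) :
    polymerDiam S ≤ (s (S.image (blockCorner c)) - 1) + (c - 1) := by
  obtain ⟨X, hX, rfl, -⟩ := exists_eq_cubeSites_of_supNorm_ne_zero W hS
  rw [image_blockCorner_cubeSites hX]
  have h1 := polymerDiam_cubeSites_le hc X
  have h2 := hs X hX
  omega

/-- **MEETING SHAPE, range-control branch (D3 = NO)**: on the support of `reindex W`, for range-controlled `W`,
`polymerDiam S ≤ c · #(corners of S) + (c − 1)`. [folklore] -/
theorem polymerDiam_le_of_supNorm_reindex_ne_zero_of_isRangeControlled (hc : 1 ≤ c) (hW : W.IsRangeControlled)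
    {S : Finset (Site d L)} (hS : (reindex W).supNorm S ≠ 0) :
    polymerDiam S ≤ c * (S.image (blockCorner c)).card + (c - 1) := by
  obtain ⟨X, hX, rfl, hsup⟩ := exists_eq_cubeSites_of_supNorm_ne_zero W hS
  rw [image_blockCorner_cubeSites hX]
  exact polymerDiam_cubeSites_le_of_isRangeControlled hc hW hX
    (exists_act_ne_zero_of_supNorm_ne_zero W (hsup ▸ hS))

/-- **MEETING SHAPE, link count**: on the support of `reindex W`, `#polymerEdges 1 S ≤ d · c^d · #(corners of S)` (the `c^d`
rider of the first-moment column). [folklore] -/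
theorem card_polymerEdges_le_of_supNorm_reindex_ne_zero (hc : 0 < c) {S : Finset (Site d L)}
    (hS : (reindex W).supNorm S ≠ 0) :
    (polymerEdges (d := d) (L := L) 1 S).card ≤ d * c ^ d * (S.image (blockCorner c)).card := by
  obtain ⟨X, hX, rfl, -⟩ := exists_eq_cubeSites_of_supNorm_ne_zero W hS
  rw [image_blockCorner_cubeSites hX]
  exact card_polymerEdges_one_cubeSites_le hc X

end Meeting

/-! ## §6 The receiver door's REAL-valued diameter line, produced

theory-2's domination door (β) takes the sender's geometry as ONE hypothesis
`hdiam : ∀ S, M S ≠ 0 → (polymerDiam S : ℝ) ≤ s S + a` (real-valued size `s`, offset `a`).  Below: that line for data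
`M` supported on the cube sets (e.g. `M = (reindex W).supNorm`), with `s S = st (corners S) − 1` and `a = c − 1`, for ANY
`st` dominating `polymerDiam + 1` on polymers (theory-2's `steinerCard` is one).  Nothing of theory-2's is mentioned:
their port file composes these three theorems with the door by name (check record: the joint monolith §J
`D3PortJoint.inBall_reindex_of_sizeData`). -/

section Joint

/-- Sizes dominating `polymerDiam + 1` on polymers are `≥ 1`, so `st (corners S) − 1 ≥ 0` as a real (the door's `hs`).
[folklore] -/
theorem size_nonneg {st : Finset (Site d L) → ℕ}
    (hst : ∀ X ∈ polymers (d := d) (L := L) c, polymerDiam X + 1 ≤ st X) (S : Finset (Site d L)) :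
    0 ≤ (st (S.image (blockCorner c)) : ℝ) - 1 := by
  have h := hst _ (image_blockCorner_mem_polymers c S)
  have h' : (1 : ℝ) ≤ st (S.image (blockCorner c)) := by
    exact_mod_cast le_trans (Nat.le_add_left 1 _) h
  linarith

/-- **The door's `hdiam`, produced**: for data supported on cube sets,
`M S ≠ 0 → (polymerDiam S : ℝ) ≤ (st (corners S) − 1) + (c − 1)`. [folklore] -/
theorem hdiam_of_supported (hc : 1 ≤ c) {st : Finset (Site d L) → ℕ}
    (hst : ∀ X ∈ polymers (d := d) (L := L) c, polymerDiam X + 1 ≤ st X)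
    {M : Finset (Site d L) → ℝ} (hM : ∀ S, M S ≠ 0 → ∃ X ∈ polymers (d := d) (L := L) c, S = cubeSites c X) :
    ∀ S, M S ≠ 0 → (polymerDiam S : ℝ) ≤ ((st (S.image (blockCorner c)) : ℝ) - 1) + ((c : ℝ) - 1) := by
  intro S hS
  obtain ⟨X, hX, rfl⟩ := hM S hS
  rw [image_blockCorner_cubeSites hX]
  have h1 := polymerDiam_cubeSites_le hc X
  have h2 := hst X hX
  have h3 : polymerDiam (cubeSites c X) + 2 ≤ st X + c := by omega
  have h4 : (polymerDiam (cubeSites c X) : ℝ) + 2 ≤ (st X : ℝ) + (c : ℝ) := by exact_mod_cast h3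
  linarith

/-- For the sup-norm datum `M = (reindex W).supNorm` the support hypothesis of `hdiam_of_supported` holds. [folklore] -/
theorem supported_supNorm_reindex [Group G] [MeasurableSpace G] (W : QuasiLocalGaugePerturbation d L G c) :
    ∀ S, (reindex W).supNorm S ≠ 0 → ∃ X ∈ polymers (d := d) (L := L) c, S = cubeSites c X :=
  fun S hS => by
    obtain ⟨X, hX, h, -⟩ := exists_eq_cubeSites_of_supNorm_ne_zero W hS
    exact ⟨X, hX, h⟩

end Joint

/-! ## §7 THE PER-SITE SUM RE-INDEXING (iv-Σ)

The receiver's doors sum per SITE over `polymersThrough 1 y`; the sender's norms sum per CORNER over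
`polymersThrough c (blockCorner c y)`.  `sum_polymersThrough_one_eq` identifies the two for any function vanishing off
the cube sets (one `sum_image` on the injective `cubeSites c` + `sum_subset`), and is specialised to the two columns of
the ℕ-shaped door (δ) for `M = (reindex W).supNorm`, `t S = s (corners S)`: the weighted-norm column VERBATIM, and the
`|S|` column with the `c^d` rider as a theorem (check record: the joint monolith §J `D3PortJoint.inBall_reindex_of_senderData`
/ `mem_clusterDomain_reindex_of_steinerData`). -/

section SumReindex

/-- The cube sets of the scale-`c` polymers through the corner of `y` are scale-`1` polymers through `y`. [folklore] -/
theorem image_cubeSites_polymersThrough_subset (y : Site d L) :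
    (polymersThrough c (blockCorner c y)).image (cubeSites c) ⊆ polymersThrough 1 y := by
  intro S hS
  obtain ⟨X, hX, rfl⟩ := mem_image.1 hS
  rw [mem_polymersThrough_iff] at hX ⊢
  exact ⟨mem_polymers_one _, mem_cubeSites_iff.2 hX.2⟩

/-- **(iv-Σ) PER-SITE SUM RE-INDEXING**: a function vanishing off the cube sets sums over the scale-`1` polymers through
`y` exactly as over the scale-`c` polymers through the corner of `y`, composed with `cubeSites c`. [folklore] -/
theorem sum_polymersThrough_one_eq {β : Type*} [AddCommMonoid β] (f : Finset (Site d L) → β)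
    (hf : ∀ S, cubeSites c (S.image (blockCorner c)) ≠ S → f S = 0) (y : Site d L) :
    ∑ S ∈ polymersThrough 1 y, f S = ∑ X ∈ polymersThrough c (blockCorner c y), f (cubeSites c X) := by
  have hinj : Set.InjOn (cubeSites (d := d) (L := L) c) ↑(polymersThrough c (blockCorner c y)) :=
    fun X hX X' hX' h => cubeSites_injOn (mem_polymersThrough_iff.1 (mem_coe.1 hX)).1
      (mem_polymersThrough_iff.1 (mem_coe.1 hX')).1 h
  rw [← sum_image hinj]
  refine (sum_subset (image_cubeSites_polymersThrough_subset y) ?_).symm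
  intro S hS hSnot
  refine hf S fun hEq => hSnot ?_
  rw [mem_polymersThrough_iff] at hS
  refine mem_image.2 ⟨S.image (blockCorner c), ?_, hEq⟩
  rw [mem_polymersThrough_iff]
  exact ⟨image_blockCorner_mem_polymers c S, mem_image_of_mem _ hS.2⟩

variable [Group G] [MeasurableSpace G] (W : QuasiLocalGaugePerturbation d L G c)

/-- (iv-Σ) for the re-indexed sup norms against any weight of the corner set: per-SITE sum at scale `1` = per-CORNER
sum at scale `c` in the sender's own terms. [folklore] -/
theorem sum_polymersThrough_supNorm_reindex_mul (φ : Finset (Site d L) → Finset (Site d L) → ℝ) (y : Site d L) :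
    ∑ S ∈ polymersThrough 1 y, (reindex W).supNorm S * φ (S.image (blockCorner c)) S
      = ∑ X ∈ polymersThrough c (blockCorner c y), W.supNorm X * φ X (cubeSites c X) := by
  rw [sum_polymersThrough_one_eq (c := c) (fun S => (reindex W).supNorm S * φ (S.image (blockCorner c)) S)
    (fun S hS => by simp only [supNorm_reindex_of_ne W hS, zero_mul]) y]
  refine sum_congr rfl fun X hX => ?_
  have hXp : X ∈ polymers c := (mem_polymersThrough_iff.1 hX).1
  rw [supNorm_reindex_cubeSites W hXp, image_blockCorner_cubeSites hXp]

/-- (iv-Σ) specialised to (δ)'s FIRST sum (`t S = s (corners S)`): the door's per-site `hη` column IS the sender's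
per-corner weighted norm `∑_{X ∋ corner y} ‖W_X‖ e^{κ_s (s X − 1)}`. [folklore] -/
theorem sum_polymersThrough_reindex_weight (s : Finset (Site d L) → ℕ) (κs : ℝ) (y : Site d L) :
    ∑ S ∈ polymersThrough 1 y, (reindex W).supNorm S * Real.exp (κs * ((s (S.image (blockCorner c)) - 1 : ℕ) : ℝ))
      = ∑ X ∈ polymersThrough c (blockCorner c y), W.supNorm X * Real.exp (κs * ((s X - 1 : ℕ) : ℝ)) :=
  sum_polymersThrough_supNorm_reindex_mul W (fun X _ => Real.exp (κs * ((s X - 1 : ℕ) : ℝ))) y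

/-- (iv-Σ) specialised to (δ)'s SECOND sum: the `|S|` column becomes `|cubeSites c X|`. [folklore] -/
theorem sum_polymersThrough_reindex_card_weight (s : Finset (Site d L) → ℕ) (κs : ℝ) (y : Site d L) :
    ∑ S ∈ polymersThrough 1 y,
        (reindex W).supNorm S * S.card * Real.exp (κs * ((s (S.image (blockCorner c)) - 1 : ℕ) : ℝ))
      = ∑ X ∈ polymersThrough c (blockCorner c y),
        W.supNorm X * (cubeSites c X).card * Real.exp (κs * ((s X - 1 : ℕ) : ℝ)) := by
  have h := sum_polymersThrough_supNorm_reindex_mul W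
    (fun X S => (S.card : ℝ) * Real.exp (κs * ((s X - 1 : ℕ) : ℝ))) y
  simpa only [mul_assoc] using h

/-- The `c^d` RIDER on (δ)'s second column: `|cubeSites c X| ≤ c^d |X|` inside the per-corner sum. [folklore] -/
theorem sum_polymersThrough_reindex_card_weight_le (hc : 0 < c) (s : Finset (Site d L) → ℕ) (κs : ℝ) (y : Site d L) :
    ∑ S ∈ polymersThrough 1 y,
        (reindex W).supNorm S * S.card * Real.exp (κs * ((s (S.image (blockCorner c)) - 1 : ℕ) : ℝ))
      ≤ (c : ℝ) ^ d * ∑ X ∈ polymersThrough c (blockCorner c y),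
        W.supNorm X * X.card * Real.exp (κs * ((s X - 1 : ℕ) : ℝ)) := by
  rw [sum_polymersThrough_reindex_card_weight W s κs y, mul_sum]
  refine sum_le_sum fun X _ => ?_
  have hcard : ((cubeSites c X).card : ℝ) ≤ (c : ℝ) ^ d * X.card := by exact_mod_cast card_cubeSites_le hc X
  have h0 : 0 ≤ W.supNorm X := W.supNorm_nonneg X
  have h1 : 0 ≤ Real.exp (κs * ((s X - 1 : ℕ) : ℝ)) := (Real.exp_pos _).le
  calc W.supNorm X * ((cubeSites c X).card : ℝ) * Real.exp (κs * ((s X - 1 : ℕ) : ℝ))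
      ≤ W.supNorm X * ((c : ℝ) ^ d * X.card) * Real.exp (κs * ((s X - 1 : ℕ) : ℝ)) :=
        mul_le_mul_of_nonneg_right (mul_le_mul_of_nonneg_left hcard h0) h1
    _ = (c : ℝ) ^ d * (W.supNorm X * X.card * Real.exp (κs * ((s X - 1 : ℕ) : ℝ))) := by ring

end SumReindex

end Summit.Ventures.YMGap.YM3IR.Reindex

end
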